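import Summits.BirchSwinnertonDyer.Rank1Residual.ManinAdditive.KummerCubeMonodromy
import HarnessLib
import HarnessLib.Audit.Tags

/-!
# E-an-57♭ `EtaCubeRootCharacterAtNine` — the period (monodromy) face of E-an-57 (cell bsd-f2-manin, -an g37, MEMO-an §80.11; T-an-42)

TYPER NOTE (typer g20, T-an-42).  SOURCE = HOME/an/g37/EtaCubeRootCharacter-an-g37.lean sha16 8c20ca9f9de08cb0 (an: farm rc 0 · 0 err · 0 warn ·
0 s∗rry; BC7 g37-bc7-etachar.out e3c3694f9ea9002b CLEAN) VERBATIM except this note.  Statement-only module: the plain def `EtaCubeRootFixed N r γ`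
(ψ_r(γ) = 0: every continuous cube root of the η-quotient `g_r` is γ-invariant; nothing asserted) and `@[conjecture]` **E-an-57♭
`EtaCubeRootCharacterAtNine`** (∃ Newman r with ker χ_T = ker ψ_r; on paper truth-equivalent to E-an-57 `CuspidalKummerThree.CuspidalKummerCubeRepresentativeAtNine`:
E-57 ⟹ E-57♭ kernel-provable from the landed σ-monodromy leaves, ⟸ needs the GAGA bridge Shimura Thm 3.52).  BC5 = the 27a1 rung VERIFIED EXACTLY
(HOME/an/g37/rung27a1-e57-rung27.py d963c0ec134f82a9 / .out e0c629f3071e1811: r = (3, −1, 1, −3)); census-scale falsifier = data ask D-an-19 (40 optimal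
curves 9 ∣ N ≤ 1000 with E(ℚ)[3] ≠ 0, 𝔽₃ linear algebra per curve).  Refuter verdict R-an-72 pending at landing time.  Imports = the landed
`…ManinAdditive.KummerCubeMonodromy` (p718910) only — ROUTE-INDEPENDENT.  No instances, no notation.  NOT IN PRINT at 9 ∣ N (nearest shape:
[Yoo2019] Conj. 1.2 / 1.3 «φ^*T ∈ 𝒞(N)»; printed Eisenstein-ideal engines need p ∤ N or N squarefree).  CITE DELTA: an's key
`Yoo2023RCGBJ0N` is not in references.bib — the same paper is the tree key `Yoo2019` (arXiv:1908.06411 = JNT 2022); locators re-read by the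
typer on the materialised text p. 3: Conjecture 1.2 (generalized Ogg), Conjecture 1.3, Remark 1.4, Theorem 1.5 (main result) — an's «Thm 1.4» is
Remark 1.4 / Thm 1.5 there.  PARTITION 0 ·
beyond-print theorem: no · bears_on stmt-BirchSwinnertonDyer-22968 (C3, node E-an-57 of LEAD's v19/v20) · BSD is not proved by this; E-an-57/57♭, C3 OPEN.

For an optimal `X₀(N)`-parametrisation `φ` of `E = E_W` (`Λ_E = c·Λ_f`), `9 ∣ N`, and a rational point `T` of
order `3` of the short model with a lift `a ∈ ⅓Λ ∖ Λ` (`ShortThreeTorsionLift`), two characters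
`Γ₀(N) → ℤ/3` appear:

* `χ_T(γ)` = the Weil pairing `e₃(T, c·{∞,γ∞}_f / 3)`, i.e. the monodromy of the `σ`-cube root
  `W_a(c·E_f(τ))` of `Θ_T^an` along `γ` (`SigmaCubeRootMonodromy`, `sigmaCubeRoot_add_of_mem_lattice`):
  `χ_T(γ) = 0 ⇔ c·{∞,γ∞}_f ∈ ℤ·3a + 3Λ`;
* `ψ_r(γ)` = the monodromy of a continuous cube root of the `η`-quotient `g_r = ∏ η(δτ)^{r_δ}` (a unit on `X₀(N)`
  under `NewmanCond N r 0`) along `γ`: `ψ_r(γ) = 0 ⇔` every continuous cube root of `g_r` on `ℍ` is `γ`-invariant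
  (`EtaCubeRootFixed`).

`EtaCubeRootCharacterAtNine` says: `∃ r` Newman with `ker χ_T = ker ψ_r` (then `χ_T = ±ψ_r = ψ_{±r}`).  On paper it is
EQUIVALENT to E-an-57 `CuspidalKummerCubeRepresentativeAtNine` and to «`φ^*(T) ∈ 𝒞(N)`» (Yoo's rational cuspidal
divisor class group): E-an-57 ⇒ E-an-57♭ by comparing monodromies of `∛Θ^an = ∛g_r · (A/B)^an` (tree tools: S1, S3,
S3′, S6, the multiplier formula, `qExpansionCubeIdentityPrinciple`-type passage); E-an-57♭ ⇒ E-an-57 needs the GAGA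
bridge «a `Γ₀(N)`-invariant meromorphic function on `ℍ ∪ cusps` with rational `q`-expansion is `A/B`, `A, B ∈ ℤ⟦q⟧`,
`A/B ∈ K_N`» (Shimura Thm. 3.52), not in the tree.  Cheapest falsifier: `𝔽₃`-linear algebra on (modular symbols of
`f`, Dedekind–Rademacher periods of `η(δτ)`) per curve — data ask D-an-19.  [folklore]
-/

set_option autoImplicit false

open PowerSeries CongruenceSubgroup Complex
open scoped MatrixGroups ModularForm PeriodPair UpperHalfPlane
open WeierstrassCurve Literature.NumberTheory.EllipticCurves Literature.NumberTheory.EllipticCurves.ModularForms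
open Summit.BirchSwinnertonDyer.Rank1Residual.ManinAdditive.CuspidalKummer
open Summit.BirchSwinnertonDyer.Rank1Residual.ManinAdditive.CuspidalKummerThree

namespace Summit.BirchSwinnertonDyer.Rank1Residual.ManinAdditive.EtaCubeRootCharacter

/-- `ψ_r(γ) = 0`: every CONTINUOUS cube root `G` of the `η`-quotient `g_r = ∏_{δ∣N} η(δτ)^{r_δ}` on `ℍ` is
`γ`-invariant.  (A continuous cube root exists — `ℍ` is simply connected and `g_r ≠ 0` there — and any two differ by a
constant cube root of unity, so `∀ G` and `∃ G` agree; for a unit `g_r` the defect `G(γτ)/G(τ) ∈ μ₃` is constant in `τ`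
and `γ ↦ G(γτ)/G(τ)` is a homomorphism `Γ₀(N) → μ₃`, the Kummer character of `∛g_r`.) [folklore] -/
def EtaCubeRootFixed (N : ℕ) (r : ℕ → ℤ) (γ : SL(2, ℤ)) : Prop :=
  ∀ G : ℂ → ℂ, ContinuousOn G {z : ℂ | 0 < z.im} → (∀ τ : ℍ, G τ ^ 3 = etaQuotient N r τ) →
    ∀ τ : ℍ, G ((γ • τ : ℍ) : ℂ) = G τ

/-- **E-an-57♭ `EtaCubeRootCharacterAtNine` (bsd-f2-manin, -an g37, MEMO-an §80.11; conjecture, research node —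
on paper equivalent to E-an-57 and to «`φ^*(T) ∈ 𝒞(N)`», beyond print at `9 ∣ N`).**
For an optimal datum (`Λ_E ⊆ c·Λ_f`), `9 ∣ N`, a rational `3`-torsion point `(X₀, Y₀)` of the short model and any lift
`a` (`a ∉ Λ`, `3a ∈ Λ`, `(c²℘(a), c³℘'(a)/2) = (X₀, Y₀)`), there is a Newman exponent vector `r` (so `g_r` is a unit
on `X₀(N)`) such that for every `γ ∈ Γ₀(N)`:
`c·{∞,γ∞}_f ∈ ℤ·3a + 3Λ` (the Weil pairing `e₃(T, c{∞,γ∞}_f/3)` is trivial, i.e. the `σ`-cube root of `Θ_T` has no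
monodromy along `γ`) **iff** every continuous cube root of `g_r` is `γ`-invariant.  Equivalently `χ_T = ψ_{±r}` as
characters `Γ₀(N) → ℤ/3`: the `μ₃`-torsor `X₀(N)(∛Θ_T) = X₀(N) ×_E E₁` is the Kummer torsor of an `η`-quotient.
The arithmetic heart is a congruence MOD 3 OF PERIODS between `f` and the weight-2 Eisenstein series
`dlog g_r /(2πi dτ) = (1/24)Σ r_δ δ E₂(δτ)` (`a_ℓ(f) ≡ 1 + ℓ`), an Eisenstein-ideal statement at `p = 3`, `9 ∣ N`
(printed engines — Mazur, Stevens, Tang 1997, Vatsal 1999/2005, Agashe 2018, Yoo 2023 — need `p ∤ N` or `N`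
squarefree / `f` ordinary at `p`; here `E` is additive at `3`).  Why it might fail: exactly when `φ^*(T) ∉ 𝒞(N)`
(a failure of generalized Ogg for this class at a level `9 ∣ N`); typed risks: none beyond E-an-57's (the `∀ a` is
harmless: `ℤ·3a + 3Λ` does not depend on the lift).  Cheapest falsifier (data, D-an-19): for each of the 40 optimal
`E` with `9 ∣ N ≤ 1000`, `E(ℚ)[3] ≠ 0`: `χ_T` on generators of `Γ₀(N)` from modular symbols, `ψ_{e_δ}` from
Dedekind sums, solve `χ_T ∈ span_{𝔽₃}{ψ_r : r Newman}`; calibration `27a1`: `r = (3, −1, 1, −3)`.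
[cite: Yoo2019, Conj. 1.2 (generalized Ogg) and Conj. 1.3, Thm. 1.5 (arXiv:1908.06411 = J. Number Theory 2022, doi:10.1016/j.jnt.2022.04.009, p. 3; shape: φ^*T ∈ 𝒞(N))] [cite: Manin1972, Prop. 1.4 (u(γτ) − u(τ) = {∞,γ∞})] -/
@[conjecture]
def EtaCubeRootCharacterAtNine : Prop :=
  ∀ (W : WeierstrassCurve ℚ) [W.IsElliptic] [W.IsGloballyMinimal] {N : ℕ} [NeZero N]
    (D : ModularParametrizationData W N), 9 ∣ N →
    (∀ z ∈ D.L.lattice, ∃ w ∈ periodLattice D.f, z = D.c * w) →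
    ∀ X₀ Y₀ : ℚ, IsShortThreeTorsion W D.c X₀ Y₀ →
    ∀ a : ℂ, a ∉ D.L.lattice → 3 * a ∈ D.L.lattice →
      (D.c : ℂ) ^ 2 * ℘[D.L] a = (X₀ : ℂ) → (D.c : ℂ) ^ 3 * ℘'[D.L] a / 2 = (Y₀ : ℂ) →
    ∃ r : ℕ → ℤ, NewmanCond N r 0 ∧
      ∀ γ : Gamma0 N,
        (∃ k : ℤ, ∃ ν ∈ D.L.lattice, (D.c : ℂ) * cuspSymbol D.f γ = k * (3 * a) + 3 * ν) ↔
          EtaCubeRootFixed N r (γ : SL(2, ℤ))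

end Summit.BirchSwinnertonDyer.Rank1Residual.ManinAdditive.EtaCubeRootCharacter
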